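import Summits.ResolutionOfSingularities.ResolutionOfSingularities.Theorems.FrobeniusLadderFRationalResolutionGaloisTwistedPointObstruction
import Summits.ResolutionOfSingularities.ResolutionOfSingularities.Theorems.FrobeniusLadderFRationalResolutionGaloisFibreUnramified
import Mathlib.RingTheory.Invariant.Galois
import Mathlib.RingTheory.Unramified.Field
import Mathlib.FieldTheory.Galois.Basic
import HarnessLib

/-!
# Crux `FrobeniusLadder.FRationalResolution` (stmt-ResolutionOfSingularities-15317), line `redirect`,
# stub `stub_diagonalizableQuotientResolution` — `κ(𝔔')/κ(𝔭)` is GALOIS: a residue class outside `κ(𝔭)` is moved by a `B`-fixing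
# automorphism; hence `hfix` ⟹ the residue embedding `ι` lands in `κ(𝔭)` (the twisted-point obstruction, field form)

For `K'/K` finite Galois, `B' = B ⊗_K K'`, `𝔭 ⊆ B` and `𝔔' ⊆ B'` maximal with `𝔔' ∩ B = 𝔭`: the residue extension `κ(𝔔')/κ(𝔭)` is
normal (Mathlib `Ideal.Quotient.normal` for the twist action, invariants `= B` by ✓ `…GaloisTwistInvariants`) and separable
(`B → B'` formally unramified, ✓ `…GaloisFibreUnramified`), hence Galois, so an element fixed by all `κ(𝔭)`-automorphisms lies in `κ(𝔭)`.

* `exists_residue_ringEquiv_ne` — a class `x ∈ B'/𝔔'` not of the form `\overline{b ⊗ 1}` is MOVED by some ring automorphism of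
  `B'/𝔔'` fixing all `\overline{b ⊗ 1}`.
* **`exists_decomposition_chartTwist_ne_of_not_mem_range`** — consequently (with ✓ `…GaloisTwistedPointObstruction`): if the chart
  point `𝔚` over `𝔔'` belongs to `ι : C/𝔔 → B'/𝔔'` and SOME value `ι(c̄)` is not of the form `\overline{b ⊗ 1}`, then some chart twist of
  the decomposition group MOVES `𝔚` — the hypothesis `hfix` of ✓ `…GaloisFixedPointPiece` forces `ι(κ(𝔔)) ⊆ κ(𝔭)`, i.e. the
  residue-trivial case. This closes item [S–M] of MEMO-15317-leafhand2-g14 §3 in its field form (memo MEMO-15317-leafhand2-g15 §2(a)).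

Honest label: plumbing/structure toward ONE leaf stub (no stub, crux or summit closed). No definitions, no named facts, no sorry.
[cite: StacksProject, Tag 0BRI; Tag 09EB; Tag 09H0]
-/

noncomputable section

-- single-problem summit: the doubled namespace component is forced
set_option linter.dupNamespace false

open TensorProduct
open scoped Pointwise

namespace Summit.ResolutionOfSingularities.ResolutionOfSingularities.Theorems.FRationalResolution.GaloisResidueGalois

variable {K K' B : Type} [Field K] [Field K'] [Algebra K K'] [CommRing B] [Algebra K B]

/-- **A residue class outside `κ(𝔭)` is moved by a `B`-fixing automorphism of `κ(𝔔')`.** `K'/K` finite Galois, `𝔭 ⊆ B` maximal,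
`𝔔' ⊆ B ⊗_K K'` maximal over `𝔭`, and `x ∈ (B ⊗_K K')/𝔔'` not the class of any `b ⊗ 1`. Then some ring automorphism `f` of
`(B ⊗_K K')/𝔔'` fixing the classes of all `b ⊗ 1` has `f x ≠ x` (`κ(𝔔')/κ(𝔭)` is finite Galois). [cite: StacksProject, Tag 0BRI; Tag 09H0] -/
theorem exists_residue_ringEquiv_ne [FiniteDimensional K K'] [IsGalois K K'] (𝔭 : Ideal B) [𝔭.IsMaximal]
    (𝔔' : Ideal (B ⊗[K] K')) [𝔔'.IsMaximal] (h𝔔'𝔭 : 𝔔'.comap (algebraMap B (B ⊗[K] K')) = 𝔭)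
    (x : (B ⊗[K] K') ⧸ 𝔔')
    (hx : ∀ b : B, Ideal.Quotient.mk 𝔔' (algebraMap B (B ⊗[K] K') b) ≠ x) :
    ∃ f : (B ⊗[K] K') ⧸ 𝔔' ≃+* (B ⊗[K] K') ⧸ 𝔔',
      (∀ b : B, f (Ideal.Quotient.mk 𝔔' (algebraMap B (B ⊗[K] K') b)) =
        Ideal.Quotient.mk 𝔔' (algebraMap B (B ⊗[K] K') b)) ∧ f x ≠ x := by
  classical
  letI : Field (B ⧸ 𝔭) := Ideal.Quotient.field 𝔭
  letI : Field ((B ⊗[K] K') ⧸ 𝔔') := Ideal.Quotient.field 𝔔'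
  -- the twist action (as in `…GaloisTwistInvariants` / `…GaloisResidueAutomorphisms`)
  let τ : (K' ≃ₐ[K] K') → (B ⊗[K] K' ≃ₐ[B] B ⊗[K] K') := fun σ =>
    Algebra.TensorProduct.congr (AlgEquiv.refl : B ≃ₐ[B] B) σ
  have hτ : ∀ σ x, τ σ x = Algebra.TensorProduct.map (AlgHom.id B B) (σ : K' →ₐ[K] K') x := by
    intro σ x
    induction x using TensorProduct.induction_on with
    | zero => simp
    | tmul b y => simp [τ, Algebra.TensorProduct.congr_apply, Algebra.TensorProduct.map_tmul]
    | add x y hx hy => rw [map_add, map_add, hx, hy]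
  have hone : ∀ x, τ 1 x = x := by
    intro x
    rw [hτ]
    induction x using TensorProduct.induction_on with
    | zero => simp
    | tmul b y => simp [Algebra.TensorProduct.map_tmul]
    | add x y hx hy => rw [map_add, hx, hy]
  have hmul : ∀ σ σ' x, τ (σ * σ') x = τ σ (τ σ' x) := by
    intro σ σ' x
    rw [hτ, hτ, hτ]
    induction x using TensorProduct.induction_on with
    | zero => simp
    | tmul b y => simp [Algebra.TensorProduct.map_tmul, AlgEquiv.mul_apply]
    | add x y hx hy => simp only [map_add, hx, hy]
  let φ : (K' ≃ₐ[K] K') →* RingAut (B ⊗[K] K') :=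
    { toFun := fun σ => (τ σ).toRingEquiv
      map_one' := by
        ext x
        exact hone x
      map_mul' := fun σ σ' => by
        ext x
        exact hmul σ σ' x }
  have hφ : ∀ σ x, φ σ x = Algebra.TensorProduct.map (AlgHom.id B B) (σ : K' →ₐ[K] K') x := fun σ x => hτ σ x
  letI : MulSemiringAction (K' ≃ₐ[K] K') (B ⊗[K] K') := MulSemiringAction.compHom (B ⊗[K] K') φ
  have hsmul : ∀ (σ : K' ≃ₐ[K] K') (x : B ⊗[K] K'),
      σ • x = Algebra.TensorProduct.map (AlgHom.id B B) (σ : K' →ₐ[K] K') x := fun σ x => hφ σ x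
  haveI : SMulCommClass (K' ≃ₐ[K] K') B (B ⊗[K] K') :=
    ⟨fun σ b x => by rw [hsmul, hsmul, map_smul]⟩
  haveI : Algebra.IsInvariant B (B ⊗[K] K') (K' ≃ₐ[K] K') :=
    ⟨fun x hx => by
      obtain ⟨b, hb⟩ := GaloisTwistInvariants.exists_eq_tmul_one_of_forall_map_eq x fun σ => by
        rw [← hsmul]; exact hx σ
      exact ⟨b, by rw [hb, Algebra.TensorProduct.algebraMap_apply, Algebra.algebraMap_self, RingHom.id_apply]⟩⟩
  haveI : 𝔔'.LiesOver 𝔭 := ⟨by rw [Ideal.under_def, h𝔔'𝔭]⟩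
  -- `κ(𝔔')/κ(𝔭)` is normal …
  haveI hnormal : Normal (B ⧸ 𝔭) ((B ⊗[K] K') ⧸ 𝔔') := Ideal.Quotient.normal (K' ≃ₐ[K] K') 𝔭 𝔔'
  -- … and separable (formally unramified of finite type), hence finite Galois
  haveI : Algebra.FormallyUnramified B (B ⊗[K] K') := GaloisFibreUnramified.formallyUnramified_baseChange K K' B
  haveI : Algebra.FormallyUnramified B ((B ⊗[K] K') ⧸ 𝔔') :=
    Algebra.FormallyUnramified.comp B (B ⊗[K] K') ((B ⊗[K] K') ⧸ 𝔔')
  haveI : Algebra.FormallyUnramified (B ⧸ 𝔭) ((B ⊗[K] K') ⧸ 𝔔') :=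
    Algebra.FormallyUnramified.of_restrictScalars (R := B) (A := B ⧸ 𝔭) (B := (B ⊗[K] K') ⧸ 𝔔')
  haveI : Algebra.FiniteType B (B ⊗[K] K') := inferInstance
  haveI : Algebra.FiniteType B ((B ⊗[K] K') ⧸ 𝔔') :=
    (inferInstance : Algebra.FiniteType B (B ⊗[K] K')).of_surjective (Ideal.Quotient.mkₐ B 𝔔')
      Ideal.Quotient.mk_surjective
  haveI : Algebra.FiniteType (B ⧸ 𝔭) ((B ⊗[K] K') ⧸ 𝔔') :=
    Algebra.FiniteType.of_restrictScalars_finiteType B (B ⧸ 𝔭) ((B ⊗[K] K') ⧸ 𝔔')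
  haveI : Algebra.IsSeparable (B ⧸ 𝔭) ((B ⊗[K] K') ⧸ 𝔔') :=
    Algebra.FormallyUnramified.isSeparable (B ⧸ 𝔭) ((B ⊗[K] K') ⧸ 𝔔')
  haveI : IsGalois (B ⧸ 𝔭) ((B ⊗[K] K') ⧸ 𝔔') := isGalois_iff.mpr ⟨inferInstance, hnormal⟩
  haveI : FiniteDimensional (B ⧸ 𝔭) ((B ⊗[K] K') ⧸ 𝔔') :=
    Ideal.Quotient.finite_of_isInvariant (K' ≃ₐ[K] K') 𝔭 𝔔'
  -- if every `κ(𝔭)`-automorphism fixed `x`, it would come from `κ(𝔭)`, i.e. from `B`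
  by_contra hcon
  push Not at hcon
  have hfix : ∀ f : ((B ⊗[K] K') ⧸ 𝔔') ≃ₐ[B ⧸ 𝔭] ((B ⊗[K] K') ⧸ 𝔔'), f x = x := fun f =>
    hcon f.toRingEquiv fun b => by
      show f (algebraMap (B ⧸ 𝔭) ((B ⊗[K] K') ⧸ 𝔔') (Ideal.Quotient.mk 𝔭 b)) =
        algebraMap (B ⧸ 𝔭) ((B ⊗[K] K') ⧸ 𝔔') (Ideal.Quotient.mk 𝔭 b)
      exact f.commutes _
  obtain ⟨r, hr⟩ := (IsGalois.mem_range_algebraMap_iff_fixed x).mpr hfix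
  obtain ⟨b, rfl⟩ := Ideal.Quotient.mk_surjective r
  exact hx b hr

/-- **`hfix` forces `ι(κ(𝔔)) ⊆ κ(𝔭)`.** `K'/K` finite Galois, `𝔭 ⊆ B` maximal, `𝔔' ⊆ B ⊗_K K'` maximal over `𝔭`, `𝔚` a point of the
chart `(B ⊗_K K') ⊗_B C` over `𝔔'` belonging to `ι : C/𝔔 → B'/𝔔'`, and `c ∈ C` with `ι(c̄)` not the class of any `b ⊗ 1`. Then some `σ`
in the decomposition group of `𝔔'` has `σ''(𝔚) ≠ 𝔚`. [cite: StacksProject, Tag 0BRI; Tag 09EB; Tag 00UW] -/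
theorem exists_decomposition_chartTwist_ne_of_not_mem_range {C : Type} [CommRing C] [Algebra B C]
    [FiniteDimensional K K'] [IsGalois K K'] (𝔭 : Ideal B) [𝔭.IsMaximal] (𝔔 : Ideal C)
    (𝔔' : Ideal (B ⊗[K] K')) [𝔔'.IsMaximal] (h𝔔'𝔭 : 𝔔'.comap (algebraMap B (B ⊗[K] K')) = 𝔭)
    (ι : C ⧸ 𝔔 →+* (B ⊗[K] K') ⧸ 𝔔') (𝔚 : Ideal ((B ⊗[K] K') ⊗[B] C))
    (h𝔚B : 𝔚.comap (algebraMap (B ⊗[K] K') ((B ⊗[K] K') ⊗[B] C)) = 𝔔')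
    (hι : ∀ (c : C) (b' : B ⊗[K] K'), Ideal.Quotient.mk 𝔔' b' = ι (Ideal.Quotient.mk 𝔔 c) →
      (Algebra.TensorProduct.includeRight : C →ₐ[B] (B ⊗[K] K') ⊗[B] C) c -
        algebraMap (B ⊗[K] K') ((B ⊗[K] K') ⊗[B] C) b' ∈ 𝔚)
    (c : C) (hc : ∀ b : B, Ideal.Quotient.mk 𝔔' (algebraMap B (B ⊗[K] K') b) ≠ ι (Ideal.Quotient.mk 𝔔 c)) :
    ∃ σ : K' ≃ₐ[K] K',
      𝔔'.map (Algebra.TensorProduct.map (AlgHom.id B B) (σ : K' →ₐ[K] K')) = 𝔔' ∧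
      𝔚.map (Algebra.TensorProduct.map (Algebra.TensorProduct.map (AlgHom.id B B) (σ : K' →ₐ[K] K'))
        (AlgHom.id B C)) ≠ 𝔚 := by
  obtain ⟨f, hf, hfx⟩ := exists_residue_ringEquiv_ne 𝔭 𝔔' h𝔔'𝔭 (ι (Ideal.Quotient.mk 𝔔 c)) hc
  refine GaloisTwistedPointObstruction.exists_decomposition_chartTwist_ne_of_ringEquiv 𝔔 𝔔' ι 𝔚 h𝔚B hι f hf
    fun heq => hfx ?_
  have := RingHom.congr_fun heq (Ideal.Quotient.mk 𝔔 c)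
  rwa [RingHom.comp_apply, RingHom.coe_coe] at this

end Summit.ResolutionOfSingularities.ResolutionOfSingularities.Theorems.FRationalResolution.GaloisResidueGalois

end
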